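import Summits.QuantumFields.YangMills.Theorems.BalabanUVNodesN15KingModelGraphTreeDecaySizeExtLegs
import Summits.QuantumFields.YangMills.Theorems.BalabanUVNodesN15KingModelGraphTreeDecayUnitSums

/-!
# BalabanUVNodes ∕ N15 — THE KING-MODEL RUNG (PART Α-n): THEOREM 3.5 (ii) (3.39)'s SHAPE IN KING's `A = 0` MODEL — a connected `G`∕`∂G` graph with King's
# external lines at FIXED unit sites `{y_υ}` and at `r` FIELD POINTS `w_1, …, w_r` summed over the unit lattice against insertions `A(w_l)` with linearly growing
# majorants: `|Σ_{w} Π_l A(w_l)·E^{(K)}(G; {y_υ}, {w_l})| ≤ C·exp[−(δ∕2)·d_tree({y_υ})]`, the constant uniform in the volume — parts Α-l (the size with tree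
# decay, (3.38)) and Α-i (the sum over the field points, (3.57)) composed
# (Track A, DAG node N15 = NE2; FAN-OUT v1.1 §N15 s3 «KING-MODEL RUNG … NE2's analogue DECIDED in the model»)

HONEST FRAMING.  Count-neutral (cell `pub-ymgap`, seat `pub-ymgap-dag-n15-e` g29; `--supports stmt-QuantumFields-27366 --as helper` = K3⁸
`SpineGivenEndpointR13SepCoPHV`).  TEMPLATE LITERATURE: C. King, *The U(1) Higgs model. I. The continuum limit*, Commun. Math. Phys. **102** (1986) 649–677
[King1986], Theorem 3.5 (ii) (3.39) p. 660 with (3.55)–(3.57) p. 662, read for the graphs of Proposition 3.6 in KING's OWN `A = 0` MODEL: internal lines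
`G^η_K`∕`∂^η_μG^η_K` (Prop. 3.7 BY NAME), external lines the kernels `ℋ_K = a_KG^η_KQ_K^*` of (3.71) to unit sites (part Η-e), the field points the unit blocks
read at their base points (part Α-i).  The insertions `A` stay ABSTRACT functions of the field point with (3.45)-type majorants `|A(w)| ≤ a_I(1 + |w − y_{υ₁}|)`; the
kernels `KG_kρ^*` of (3.44) tying a field to the graph and the sum over `H̃` in (3.55) are NOT typed.  NOT Bałaban's `G(U)`; NOT a node discharge; nothing
continuum ∕ ℝ⁴ ∕ OS ∕ mass-gap ∕ Clay.  0 `sorry`; standard axioms.  Text layer of pp. 660–662 (`paper:king1986-cmp102-king-u1-higgs-i` p0012–p0014) re-read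
by this seat 2026-08-29.

THE PRINT.  p. 660 [PDF 12], Theorem 3.5 (ii) (3.39): *«|E^{(k)}(H, A^{(k)}; {y_i}, {z_q})| ≤ C(L^kε)^{…}(p(L^kε))^{n₁}‖A^{(k)}‖^{r}… exp[−δ dist({y_i}, {z_q})]»*;
p. 662 [PDF 14]: *«E^{(k)}(H, A^{(k)}; {y_i}, {z_q}) = Σ_{H̃} Σ_{w_1,…,w_r ∈ T^{(k)}} A_k(w_1)⋯A_k(w_r) E^{(k)}(H̃; {y_i}, {z_q}, {w_l}) (3.55) … we can use the exponential
tree decay in (3.56) to sum over {w_l} and get (3.39)» (3.57)*.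

WHAT THIS FILE PROVES (namespace `Summit.QuantumFields.YangMills.BalabanUVNodes.N15KingModelRung.Curved`).
* ★ `anchors_sum_elim_superset` — the anchors of a family of legs indexed by `Υ ⊕ Fin r` contain the anchors of the `Υ`-legs and the `r` field points.
* ★★★ **`king_thm35_fieldPoints_extLegs_treeDecay`** — for odd `L ≥ 3`, `a > 0`, `m₀² ≥ 0` there are `C₁, C₂, Q, δ > 0` such that for every mass `0 < m² ≤ m₀²`,
  index `jv`, every CONNECTED numbered graph (kinds `κ`, (3.77) verbatim `PosDegrees (kingDegList …)` along every ordering), every family `Υ` of King's external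
  lines at fixed unit sites (`υ₀` at the vertex `0`; a reference leg `υ₁`), every `r ≥ 1` further external lines at FIELD POINTS (vertices `vtxF`, kinds `κF`) and
  every insertion `A` with `|A(w)| ≤ a_I(1 + |basePt w − y_{υ₁}|)`:
  `|Σ_{w : Fin r → Tor (kingVol)} (Π_l A(w_l))·E^{(K)}(G; legs at {y_υ} and {basePt w_l})|`
  `≤ (Q·c368(δ))·C₁^m·C₂^{nn}·(Σ_π degConst)·Q^{|Υ| + r − 1} · exp[−(δ∕2)·treeLength |·| {y_υ}] · (a_I(1 + 4r∕δ)·e^{δ∕4r}K_{d+1}(δ∕4r))^r` — (3.39)'s shape: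
  exponential tree decay in the FIXED external points after the field points are summed out, uniformly in the volume `2L^{jv.m}`.
* §2 (v1.1) ★★★ **`king_prop36_fieldPoints_extLegs_treeDecay`** — (3.56) SUMMED OVER THE FIELD POINTS: under p. 664's sentence (`PosSubgraphsBy`), with `C ≥ 1`,
  `γ, δ > 0`: `|Σ_w (Π_l A(w_l))·(E^{(K+n)} − E^{(K)})(G; {y_υ}, {w_l})| ≤ L^{−γK}·C^{2m+nn+|Υ|+r}·m!·(m+|Υ|+r+1)·exp[−(δ∕2)·treeLength{y_υ}]·(a_I(1+4r∕δ)e^{δ∕4r}K_{d+1}(δ∕4r))^r`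
  — the two-spacing RATE survives the sum over the field points (part Α-g `_collected` on `Υ ⊕ Fin r` + part Α-i): King's use of the tree decay, p. 662.

HONEST SCOPE.  (a) The composition (3.38) + (3.57) ⇒ (3.39) for (3.56)-type graphs with abstract insertions; Theorem 3.5's own objects (`H ∈ 𝒫^{n₀,n₁}`, the
fields `A^{(θ)}`, the norms `‖A‖`, `p(L^kε)`) and §3.5 are NOT typed.  (b) `treeLength` = minimum over connecting edge sets (attained at a minimal one, part Α-m).
Locators: [King1986] Thm 3.5 (3.38)–(3.39) p.660, (3.45) p.661, (3.55)–(3.57) p.662, Prop. 3.8 (3.71) p.664, (3.68) p.664, (3.77) p.666.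
-/

noncomputable section

namespace Summit.QuantumFields.YangMills.BalabanUVNodes.N15KingModelRung.Curved

open scoped BigOperators
open Finset
open Literature.MathematicalPhysics.QuantumFieldTheory.Balaban1983to89.B4Sect5Proof (latticeConst latticeConst_nonneg)
open Literature.MathematicalPhysics.QuantumFieldTheory.Balaban1983to89.B5Prop11Plancherel (Tor fine)
open Summit.QuantumFields.YangMills.BalabanUVNodes.N15KingModelRung (KingVolIndex kingVol kingVol_neZero basePt)
open Summit.QuantumFields.YangMills.BalabanUVNodes.N15KingModelRung.Graph

/-- ★ the anchors of legs indexed by `Υ ⊕ Fin r` (all anchored, at `pt`) contain the `Υ`-anchors and the images of the `r` field points. [folklore] -/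
theorem anchors_sum_elim_superset {T : Type*} [DecidableEq T] {Υ : Type} [Fintype Υ] {B : Type*} {r : ℕ} (pt : B → T) (b : Υ → B) (bF : Fin r → B) :
    anchors (fun υ => some (pt (b υ))) ∪ univ.image (fun l => pt (bF l)) ⊆ anchors (fun υ : Υ ⊕ Fin r => some (pt (Sum.elim b bF υ))) := by
  intro x hx
  rw [mem_anchors]
  rcases mem_union.1 hx with hx | hx
  · obtain ⟨υ, hυ⟩ := (mem_anchors _).1 hx
    exact ⟨Sum.inl υ, by simpa using hυ⟩
  · obtain ⟨l, -, hl⟩ := mem_image.1 hx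
    exact ⟨Sum.inr l, by simp [hl]⟩

variable {d : ℕ} (L : ℕ) [NeZero L]

section Thm35

/-- ★★★ **THEOREM 3.5 (ii) (3.39)'s SHAPE, BY NAME AT `A = 0`**: for odd `L ≥ 3`, `a > 0`, `m₀² ≥ 0` there are `C₁, C₂, Q, δ > 0` such that for every mass
`0 < m² ≤ m₀²`, index `jv`, every CONNECTED numbered graph with King's full `A = 0` propagators (kinds `κ`) and positive King degrees along every ordering ((3.77)
verbatim), every family `Υ` of King's external lines at fixed unit sites (`vtx`, blocks `b`, kinds `κe`; `υ₀` at the vertex `0`; a reference leg `υ₁`), every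
`r ≥ 1` external lines at FIELD POINTS (vertices `vtxF`, kinds `κF`), and every insertion `A` on the unit blocks with `|A(w)| ≤ a_I(1 + |basePt w − y_{υ₁}|)`:
`|Σ_{w : Fin r → Tor (kingVol)} (Π_l A(w_l))·E^{(K)}(G; {y_υ}, {basePt w_l})| ≤ (Q·c368 d δ)·(C₁^m·C₂^{nn}·(Σ_π degConst L (kingDegList …))·Q^{|Υ|+r−1})`
`· exp[−(δ∕2)·treeLength |·| {y_υ}] · (a_I·(1 + 4r∕δ)·(e^{δ∕(4r)}·K_{d+1}(δ∕(4r))))^r` — part Α-l's size with tree decay on the family `Υ ⊕ Fin r`, then part Α-i's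
sum over the field points; uniform in the volume. [cite: King1986, Thm 3.5 (3.39) p.660, (3.55)–(3.57) p.662 («use the exponential tree decay in (3.56) to sum
over {w_l} and get (3.39)»), (3.45) p.661, Prop. 3.8 (3.71) p.664, (3.77) p.666] -/
theorem king_thm35_fieldPoints_extLegs_treeDecay (hLodd : Odd L) (hL : 2 ≤ L) {a : ℝ} (ha : 0 < a) {m0sq : ℝ} (hm0 : 0 ≤ m0sq) :
    ∃ C₁ C₂ Q δ : ℝ, 0 < C₁ ∧ 0 < C₂ ∧ 0 < Q ∧ 0 < δ ∧ ∀ (msq : ℝ), 0 < msq → msq ≤ m0sq → ∀ (jv : KingVolIndex d)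
      (nn m : ℕ) (src tgt : Fin m → Fin (nn + 1)), (∀ v, LConn src tgt univ 0 v) →
      ∀ (κ : Fin m → Option (Fin (d + 1))),
        (∀ π : Equiv.Perm (Fin m), PosDegrees (kingDegList src tgt ((d + 1 : ℕ) : ℝ) (fun ℓ => lineExp (d + 1) (κ ℓ)) π)) →
      ∀ (Υ : Type) [Fintype Υ] [DecidableEq Υ] (vtx : Υ → Fin (nn + 1)) (υ₀ : Υ), vtx υ₀ = 0 →
      ∀ (b : Υ → Tor (kingVol L jv)) (κe : Υ → Option (Fin (d + 1))) (υ₁ : Υ) (r : ℕ), 1 ≤ r →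
      ∀ (vtxF : Fin r → Fin (nn + 1)) (κF : Fin r → Option (Fin (d + 1))) (aI : ℝ), 0 ≤ aI → ∀ (A : Tor (kingVol L jv) → ℝ),
        (haveI := kingVol_neZero L jv
         ∀ w, |A w| ≤ aI * (1 + kingDist L jv (basePt (L ^ jv.K) (kingVol L jv) w) (basePt (L ^ jv.K) (kingVol L jv) (b υ₁)))) →
        haveI := kingVol_neZero L jv
        |∑ w : Fin r → Tor (kingVol L jv), (∏ l, A (w l))
            * graphValLS ((((L : ℝ) ^ jv.K)⁻¹) ^ (d + 1)) src tgt (fun ℓ => kingGLine L (kingVol L jv) a msq jv.K (κ ℓ)) (Sum.elim vtx vtxF)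
                (fun υ => kingExtLo L a msq jv (Sum.elim b w υ) (Sum.elim κe κF υ))|
          ≤ (Q * c368 d δ) * (C₁ ^ m * C₂ ^ nn
                * (∑ π : Equiv.Perm (Fin m), degConst L (kingDegList src tgt ((d + 1 : ℕ) : ℝ) (fun ℓ => lineExp (d + 1) (κ ℓ)) π))
                * Q ^ (Fintype.card Υ + r - 1))
            * Real.exp (-(δ / 2 * treeLength (kingDist L jv) (anchors fun υ => some (basePt (L ^ jv.K) (kingVol L jv) (b υ)))))
            * (aI * (1 + 4 * r / δ) * (Real.exp (δ / (4 * r)) * latticeConst (d + 1) (δ / (4 * r)))) ^ r := by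
  obtain ⟨C₁, C₂, Q, δ, hC₁, hC₂, hQ, hδ, H⟩ := king_graph_size_extLegs_treeDecay (d := d) L hLodd hL ha hm0
  refine ⟨C₁, C₂, Q, δ, hC₁, hC₂, hQ, hδ,
    fun msq hm hcap jv nn m src tgt hconn κ hking Υ _ _ vtx υ₀ hυ₀ b κe υ₁ r hr vtxF κF aI haI A hA => ?_⟩
  haveI := kingVol_neZero L jv
  set ρ := kingDist L jv with hρ
  set U : Finset (Tor (fine (L ^ jv.K) (kingVol L jv))) := anchors fun υ => some (basePt (L ^ jv.K) (kingVol L jv) (b υ)) with hU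
  have hu₁ : basePt (L ^ jv.K) (kingVol L jv) (b υ₁) ∈ U := (mem_anchors _).2 ⟨υ₁, rfl⟩
  -- the constant of part Α-l on the family `Υ ⊕ Fin r`
  set B : ℝ := (Q * c368 d δ) * (C₁ ^ m * C₂ ^ nn
      * (∑ π : Equiv.Perm (Fin m), degConst L (kingDegList src tgt ((d + 1 : ℕ) : ℝ) (fun ℓ => lineExp (d + 1) (κ ℓ)) π))
      * Q ^ (Fintype.card Υ + r - 1)) with hB
  have hdeg : 0 ≤ ∑ π : Equiv.Perm (Fin m), degConst L (kingDegList src tgt ((d + 1 : ℕ) : ℝ) (fun ℓ => lineExp (d + 1) (κ ℓ)) π) :=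
    sum_nonneg fun π _ => zero_le_one.trans (one_le_degConst L hL (hking π))
  have hB0 : 0 ≤ B := by
    have := c368_pos d hδ
    positivity
  -- the kernel: part Α-l's size with tree decay in ALL the external points, weakened to `U ∪ {basePt w_l}` (a subset of the anchors)
  have hE : ∀ w : Fin r → Tor (kingVol L jv),
      |graphValLS ((((L : ℝ) ^ jv.K)⁻¹) ^ (d + 1)) src tgt (fun ℓ => kingGLine L (kingVol L jv) a msq jv.K (κ ℓ)) (Sum.elim vtx vtxF)
          (fun υ => kingExtLo L a msq jv (Sum.elim b w υ) (Sum.elim κe κF υ))|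
        ≤ B * Real.exp (-(δ * treeLength ρ (U ∪ univ.image (fun l => basePt (L ^ jv.K) (kingVol L jv) (w l))))) := fun w => by
    have key := H msq hm hcap jv nn m src tgt hconn κ hking (Υ ⊕ Fin r) (Sum.elim vtx vtxF) (Sum.inl υ₀)
      (by rw [Sum.elim_inl]; exact hυ₀) (Sum.elim b w) (Sum.elim κe κF)
    have hprod : ∏ _υ ∈ (univ : Finset (Υ ⊕ Fin r)).erase (Sum.inl υ₀), Q = Q ^ (Fintype.card Υ + r - 1) := by
      rw [prod_const, card_erase_of_mem (mem_univ _), card_univ, Fintype.card_sum, Fintype.card_fin]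
    rw [hprod] at key
    have hmono := treeLength_mono ρ (anchors_sum_elim_superset (basePt (L ^ jv.K) (kingVol L jv)) b w)
    refine key.trans ?_
    rw [mul_comm]
    exact mul_le_mul_of_nonneg_left (Real.exp_le_exp.2 (by nlinarith)) hB0
  exact king_sum_fieldPoints_treeDecay L jv hu₁ hr hδ haI hB0 _ hE A hA

end Thm35

/-! ## §2 (v1.1) Proposition 3.6 (3.56) summed over the field points — the convergence rate survives the sum -/

section Prop36Summed

/-- ★★★ **(3.56) SUMMED OVER THE FIELD POINTS, BY NAME AT `A = 0`** — the use King makes of the tree decay (p. 662: «use the exponential tree decay in (3.56)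
to sum over {w_l}»): for odd `L ≥ 3`, `a > 0`, `m₀² ≥ 0` there are `C ≥ 1`, `γ, δ > 0` such that for every mass `0 < m² ≤ m₀²`, index `jv`, `n ≥ 1`, every
CONNECTED numbered graph (kinds `κ`) satisfying p. 664's sentence `PosSubgraphsBy src tgt 0 (d+1) (lineExp ∘ κ)`, every family `Υ` of King's external lines at
fixed unit sites (`υ₀` at the vertex `0`, reference leg `υ₁`), every `r ≥ 1` external lines at FIELD POINTS and every insertion `|A(w)| ≤ a_I(1 + |basePt w − y_{υ₁}|)`:
`|Σ_w (Π_l A(w_l))·(E^{(K+n)}(G; {y_υ}, {w_l}) − E^{(K)}(G; {y_υ}, {w_l}))|`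
`≤ L^{−γK}·C^{2m+nn+|Υ|+r}·m!·(m + |Υ| + r + 1) · exp[−(δ∕2)·treeLength |·| {y_υ}] · (a_I(1 + 4r∕δ)·e^{δ∕(4r)}K_{d+1}(δ∕(4r)))^r` — the two-spacing rate
`L^{−γK}` of part Α-g SURVIVES the sum over the field points, with tree decay in the fixed points, uniformly in the volume: the field-point-summed graph values
converge as `K → ∞`. [cite: King1986, Prop. 3.6 (3.56) + (3.57) p.662, (3.45) p.661, p.664, Prop. 3.8 (3.71) p.664] -/
theorem king_prop36_fieldPoints_extLegs_treeDecay (hLodd : Odd L) (hL : 2 ≤ L) {a : ℝ} (ha : 0 < a) {m0sq : ℝ} (hm0 : 0 ≤ m0sq) :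
    ∃ C γ δ : ℝ, 1 ≤ C ∧ 0 < γ ∧ 0 < δ ∧ ∀ (msq : ℝ), 0 < msq → msq ≤ m0sq → ∀ (jv : KingVolIndex d) (n : ℕ), 1 ≤ n →
      ∀ (nn m : ℕ) (src tgt : Fin m → Fin (nn + 1)), (∀ v, LConn src tgt univ 0 v) →
      ∀ (κ : Fin m → Option (Fin (d + 1))), PosSubgraphsBy src tgt 0 ((d + 1 : ℕ) : ℝ) (fun ℓ => lineExp (d + 1) (κ ℓ)) →
      ∀ (Υ : Type) [Fintype Υ] [DecidableEq Υ] (vtx : Υ → Fin (nn + 1)) (υ₀ : Υ), vtx υ₀ = 0 →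
      ∀ (b : Υ → Tor (kingVol L jv)) (κe : Υ → Option (Fin (d + 1))) (υ₁ : Υ) (r : ℕ), 1 ≤ r →
      ∀ (vtxF : Fin r → Fin (nn + 1)) (κF : Fin r → Option (Fin (d + 1))) (aI : ℝ), 0 ≤ aI → ∀ (A : Tor (kingVol L jv) → ℝ),
        (haveI := kingVol_neZero L jv
         ∀ w, |A w| ≤ aI * (1 + kingDist L jv (basePt (L ^ jv.K) (kingVol L jv) w) (basePt (L ^ jv.K) (kingVol L jv) (b υ₁)))) →
        haveI := kingVol_neZero L jv
        |∑ w : Fin r → Tor (kingVol L jv), (∏ l, A (w l))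
            * (graphValLS ((((L : ℝ) ^ (jv.K + n))⁻¹) ^ (d + 1)) src tgt (fun ℓ => kingGLine L (kingVol L jv) a msq (jv.K + n) (κ ℓ))
                  (Sum.elim vtx vtxF) (fun υ => kingExtHi L a msq jv n (Sum.elim b w υ) (Sum.elim κe κF υ))
              - graphValLS ((((L : ℝ) ^ jv.K)⁻¹) ^ (d + 1)) src tgt (fun ℓ => kingGLine L (kingVol L jv) a msq jv.K (κ ℓ))
                  (Sum.elim vtx vtxF) (fun υ => kingExtLo L a msq jv (Sum.elim b w υ) (Sum.elim κe κF υ)))|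
          ≤ ((L : ℝ) ^ (-(γ * jv.K)) * (C ^ (2 * m + nn + (Fintype.card Υ + r))
                * ((m.factorial : ℝ) * (m + (Fintype.card Υ + r) + 1))))
            * Real.exp (-(δ / 2 * treeLength (kingDist L jv) (anchors fun υ => some (basePt (L ^ jv.K) (kingVol L jv) (b υ)))))
            * (aI * (1 + 4 * r / δ) * (Real.exp (δ / (4 * r)) * latticeConst (d + 1) (δ / (4 * r)))) ^ r := by
  obtain ⟨C, γ, δ, hC, hγ, hδ, H⟩ := king_prop36_extLegs_treeDecay_collected (d := d) L hLodd hL ha hm0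
  refine ⟨C, γ, δ, hC, hγ, hδ,
    fun msq hm hcap jv n hn nn m src tgt hconn κ hsub Υ _ _ vtx υ₀ hυ₀ b κe υ₁ r hr vtxF κF aI haI A hA => ?_⟩
  haveI := kingVol_neZero L jv
  set U : Finset (Tor (fine (L ^ jv.K) (kingVol L jv))) := anchors fun υ => some (basePt (L ^ jv.K) (kingVol L jv) (b υ)) with hU
  have hu₁ : basePt (L ^ jv.K) (kingVol L jv) (b υ₁) ∈ U := (mem_anchors _).2 ⟨υ₁, rfl⟩
  have hC0 : 0 ≤ C := zero_le_one.trans hC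
  set B : ℝ := (L : ℝ) ^ (-(γ * jv.K)) * (C ^ (2 * m + nn + (Fintype.card Υ + r))
      * ((m.factorial : ℝ) * (m + (Fintype.card Υ + r) + 1))) with hB
  have hB0 : 0 ≤ B := by positivity
  -- the kernel: part Α-g's two-spacing difference with tree decay in ALL the external points, on the family `Υ ⊕ Fin r`
  have hE : ∀ w : Fin r → Tor (kingVol L jv),
      |graphValLS ((((L : ℝ) ^ (jv.K + n))⁻¹) ^ (d + 1)) src tgt (fun ℓ => kingGLine L (kingVol L jv) a msq (jv.K + n) (κ ℓ))
            (Sum.elim vtx vtxF) (fun υ => kingExtHi L a msq jv n (Sum.elim b w υ) (Sum.elim κe κF υ))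
        - graphValLS ((((L : ℝ) ^ jv.K)⁻¹) ^ (d + 1)) src tgt (fun ℓ => kingGLine L (kingVol L jv) a msq jv.K (κ ℓ))
            (Sum.elim vtx vtxF) (fun υ => kingExtLo L a msq jv (Sum.elim b w υ) (Sum.elim κe κF υ))|
        ≤ B * Real.exp (-(δ * treeLength (kingDist L jv) (U ∪ univ.image (fun l => basePt (L ^ jv.K) (kingVol L jv) (w l))))) :=
      fun w => by
    have key := H msq hm hcap jv n hn nn m src tgt hconn κ hsub (Υ ⊕ Fin r) (Sum.elim vtx vtxF) (Sum.inl υ₀)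
      (by rw [Sum.elim_inl]; exact hυ₀) (Sum.elim b w) (Sum.elim κe κF)
    rw [Fintype.card_sum, Fintype.card_fin] at key
    push_cast at key
    have hmono := treeLength_mono (kingDist L jv) (anchors_sum_elim_superset (basePt (L ^ jv.K) (kingVol L jv)) b w)
    have hexp : Real.exp (-(δ * treeLength (kingDist L jv) (anchors fun υ => some (basePt (L ^ jv.K) (kingVol L jv) (Sum.elim b w υ)))))
        ≤ Real.exp (-(δ * treeLength (kingDist L jv) (U ∪ univ.image (fun l => basePt (L ^ jv.K) (kingVol L jv) (w l))))) :=
      Real.exp_le_exp.2 (by nlinarith)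
    calc _ ≤ _ := key
      _ = B * Real.exp (-(δ * treeLength (kingDist L jv) (anchors fun υ => some (basePt (L ^ jv.K) (kingVol L jv) (Sum.elim b w υ))))) := by
          rw [hB]; ring
      _ ≤ _ := mul_le_mul_of_nonneg_left hexp hB0
  exact king_sum_fieldPoints_treeDecay L jv hu₁ hr hδ haI hB0 _ hE A hA

end Prop36Summed

end Summit.QuantumFields.YangMills.BalabanUVNodes.N15KingModelRung.Curved

end
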